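import Literature.NumberTheory.Transcendental.PhilipponZeroEstimateChain
import HarnessLib

/-!
# Philippon's zero estimate on `𝔾ₐ × 𝔾ₘ^n`: the EXACT Bézout constant along a chain of cuts

Topic `Literature/NumberTheory/Transcendental`. Companion of `PhilipponZeroEstimateHilbert.lean`
and `PhilipponZeroEstimateChain.lean` (the tree's inline proof of `Philippon1986_GaGm`, after
D. Roy, LNM 1752, Ch. 11). There the Bézout step along a chain of ideals
`(0) = 𝔍₀ ≤ 𝔍₁ ≤ ⋯ ≤ 𝔍_r`, `𝔍_j + (Q_{j+1}) ≤ 𝔍_{j+1}` with `Q_{j+1} ∈ Box(1)` a non-zero-divisor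
modulo `𝔍_j`, is the LOSSY pointwise bound `GaGm.hilbI_chain_le`
(`H_{𝔍_j}(t) ≤ 2^{(n+1)j} D₀D₁ⁿ (t+1)^{n+1-j}`, obtained from the doubling trick
`(t+1)H'(t) ≤ ∑_{s ≤ 2t+1} H'(s)`), which costs a factor `2^{(n+1)r}` in the constant of the zero
estimate. This file proves the EXACT leading-coefficient version, with the sharp constant
`𝓗(G; D₀, D₁) = (n+1)! D₀ D₁ⁿ = mult_{D₀,D₁}(G)` of Roy's Prop. 2.2 / Philippon's Prop. 3.3 — the
form in which the constant of Philippon's zero estimate on `G` becomes Nesterenko's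
`𝓗(G; D₀, D₁, …, Dₙ)` (LNM 1819, Prop. 5.1, formula (5.7)). Everything is PROVED; no named facts.

The mechanism (iterated partial sums instead of doubling). The section inequality for a
non-zero-divisor (`GaGm.hilbI_sup_span_add_le_of_nzd`) telescopes to
`∑_{s ≤ t} H_{𝔍_{j+1}}(s) ≤ H_{𝔍_j}(t)` (`sum_hilbI_le_of_nzd`): the partial-sum operator `S`
satisfies `S H_{𝔍_{j+1}} ≤ H_{𝔍_j}` pointwise, hence `S^r H_{𝔍_r} ≤ H_{𝔍_0} = H_{(0)}`. A binomial
minorant `∑ᵢ ρᵢ·binom(t - cᵢ + k, k) ≤ H_{𝔍_r}(t)` (`t ≫ 0`) is transported by `S` to the minorant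
`∑ᵢ ρᵢ·binom(t - cᵢ' + k + 1, k + 1)` of `H_{𝔍_{r-1}}` (hockey-stick identity
`∑_{i ≤ N} binom(i + k, k) = binom(N + k + 1, k + 1)`, `choose_succ_le_sum_Ico_choose`,
`sum_mul_choose_succ_le`), and after `r` steps to a minorant of
`H_{(0)}(t) = (tD₀+1)(tD₁+1)ⁿ ≤ (n+1)! D₀D₁ⁿ·binom(t + n + 1, n + 1)` (`GaGm.hasMult_univ`) in
dimension `k + r = n + 1`; comparison of leading coefficients (`GaGm.Asymp.sum_le_of_choose_ineq`)
gives `∑ᵢ ρᵢ ≤ (n+1)! D₀ D₁ⁿ` with NO loss. PROVED: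

* `choose_succ_le_sum_Ico_choose`, `sum_mul_choose_succ_le` — the arithmetic of one transport step;
* `sum_hilbI_le_of_nzd` — `∑_{s ≤ t} H_{J'}(s) ≤ H_J(t)` for `J + (Q) ≤ J'`, `Q ∈ Box(1)` a
  non-zero-divisor modulo `J ≠ (1)`;
* `chain_transport` — a binomial minorant of `H_{𝔍_j}` in dimension `k` yields one of `H_{𝔍_0}`
  in dimension `k + j`;
* **`sum_le_of_chain`** — the exact Bézout inequality along a chain: a binomial minorant
  `∑ᵢ ρᵢ·binom(t - cᵢ + k, k) ≤ H_{𝔍_r}(t)` with `k + r = n + 1` forces `∑ᵢ ρᵢ ≤ (n+1)! D₀ D₁ⁿ`;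
* `exists_chain` — the chain of generic cuts of `PhilipponZeroEstimateChain.exists_ideal_hilbI_le`
  (Roy's Prop. 2.2: generic members `Q₁, …, Q_r` of `span F`, localised at finitely many primes
  `𝔭ᵢ ∌ u`, Cohen–Macaulayness of `B_{𝔭ᵢ}`), exported AS A CHAIN (rather than through its lossy
  Hilbert-function bound) so that `sum_le_of_chain` applies to it;
* `exists_ideal_sum_le` — the two combined: an ideal `𝔍 ≤ loc_{𝔭ᵢ}(F)` (all `i`) every binomial
  minorant of whose Hilbert function in dimension `n + 1 - r` has total coefficient `≤ (n+1)! D₀ D₁ⁿ`.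

## References

* Yu. V. Nesterenko, P. Philippon (eds.), *Introduction to Algebraic Independence Theory*,
  LNM 1752, Springer 2001, Ch. 11 (D. Roy), §2.2 (iii) (Bézout's Lemma), Prop. 2.2 (pp. 202–204).
* P. Philippon, *Lemmes de zéros dans les groupes algébriques commutatifs*, Bull. Soc. Math.
  France 114 (1986), 355–383, Prop. 3.3.
* Yu. V. Nesterenko, *Linear forms in logarithms of rational numbers*, in: Diophantine
  Approximation (Cetraro 2000), LNM 1819, Springer 2003, 53–106, §5.1, Prop. 5.1 and (5.7).
-/

noncomputable section

open MvPolynomial Module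

namespace Literature.NumberTheory.Transcendental

namespace GaGm

variable {n : ℕ} {D₀ D₁ : ℕ}

/-! ### The arithmetic of one transport step (hockey stick) -/

/-- **Shifted hockey stick (inequality).** For `t₀ ≤ t`:
`binom(t - (c + t₀) + k + 1, k + 1) ≤ ∑_{t₀ ≤ s ≤ t} binom(s - c + k, k)` (truncated subtraction;
for `t ≥ c + t₀` this is the hockey-stick identity `∑_{i ≤ N} binom(i + k, k) = binom(N + k + 1, k + 1)`
applied to the sub-sum over `c + t₀ ≤ s ≤ t` and monotonicity of `binom(·, k)`; for `t < c + t₀`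
the left side is `1`). [folklore] -/
private theorem choose_succ_le_sum_Ico_choose (c k t₀ t : ℕ) (ht : t₀ ≤ t) :
    (t - (c + t₀) + (k + 1)).choose (k + 1) ≤ ∑ s ∈ Finset.Ico t₀ (t + 1), (s - c + k).choose k := by
  by_cases hct : c + t₀ ≤ t
  · -- the sub-sum over `Ico (c + t₀) (t + 1)`, reindexed by `s = i + (c + t₀)`
    have hre : ∑ i ∈ Finset.range (t - (c + t₀) + 1), (i + (c + t₀) - c + k).choose k ≤
        ∑ s ∈ Finset.Ico t₀ (t + 1), (s - c + k).choose k := by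
      have e : ∑ i ∈ Finset.range (t - (c + t₀) + 1), (i + (c + t₀) - c + k).choose k =
          ∑ s ∈ (Finset.range (t - (c + t₀) + 1)).map (addRightEmbedding (c + t₀)), (s - c + k).choose k := by
        rw [Finset.sum_map]; rfl
      rw [e]
      refine Finset.sum_le_sum_of_subset_of_nonneg ?_ (fun _ _ _ => Nat.zero_le _)
      intro x hx
      simp only [Finset.mem_map, Finset.mem_range, addRightEmbedding_apply] at hx
      obtain ⟨i, hi, rfl⟩ := hx
      rw [Finset.mem_Ico]; omega
    refine le_trans ?_ hre
    rw [show t - (c + t₀) + (k + 1) = t - (c + t₀) + k + 1 by omega, ← Nat.sum_range_add_choose]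
    exact Finset.sum_le_sum fun i _ => Nat.choose_le_choose k (by omega)
  · -- `t < c + t₀`: the left side is `binom(k+1, k+1) = 1`, the term at `s = t₀` is `≥ 1`
    rw [show t - (c + t₀) = 0 by omega, Nat.zero_add, Nat.choose_self]
    have hmem : t₀ ∈ Finset.Ico t₀ (t + 1) := by rw [Finset.mem_Ico]; omega
    refine le_trans ?_ (Finset.single_le_sum (f := fun s => (s - c + k).choose k)
      (fun _ _ => Nat.zero_le _) hmem)
    exact Nat.succ_le_of_lt (Nat.choose_pos (by omega))

/-- **One transport step.** If `∑_{s ≤ t} g(s) ≤ f(t)` for all `t` and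
`∑ᵢ ρᵢ·binom(t - cᵢ + k, k) ≤ g(t)` for `t ≥ t₀`, then
`∑ᵢ ρᵢ·binom(t - (cᵢ + t₀) + k + 1, k + 1) ≤ f(t)` for `t ≥ t₀`: the partial-sum operator raises
the dimension of a binomial minorant by one and keeps its coefficients. [folklore] -/
private theorem sum_mul_choose_succ_le {ι : Type*} (s : Finset ι) (ρ c : ι → ℕ) (k t₀ : ℕ) {f g : ℕ → ℕ}
    (hfg : ∀ t, ∑ s' ∈ Finset.range (t + 1), g s' ≤ f t)
    (h : ∀ t, t₀ ≤ t → ∑ i ∈ s, ρ i * (t - c i + k).choose k ≤ g t) (t : ℕ) (ht : t₀ ≤ t) :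
    ∑ i ∈ s, ρ i * (t - (c i + t₀) + (k + 1)).choose (k + 1) ≤ f t := by
  calc ∑ i ∈ s, ρ i * (t - (c i + t₀) + (k + 1)).choose (k + 1)
      ≤ ∑ i ∈ s, ρ i * ∑ s' ∈ Finset.Ico t₀ (t + 1), (s' - c i + k).choose k :=
        Finset.sum_le_sum fun i _ => Nat.mul_le_mul_left _ (choose_succ_le_sum_Ico_choose _ _ _ _ ht)
    _ = ∑ s' ∈ Finset.Ico t₀ (t + 1), ∑ i ∈ s, ρ i * (s' - c i + k).choose k := by
        rw [Finset.sum_comm]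
        exact Finset.sum_congr rfl fun i _ => Finset.mul_sum _ _ _
    _ ≤ ∑ s' ∈ Finset.Ico t₀ (t + 1), g s' :=
        Finset.sum_le_sum fun s' hs' => h s' (Finset.mem_Ico.mp hs').1
    _ ≤ ∑ s' ∈ Finset.range (t + 1), g s' := by
        refine Finset.sum_le_sum_of_subset_of_nonneg (fun x hx => ?_) (fun _ _ _ => Nat.zero_le _)
        rw [Finset.mem_Ico] at hx
        rw [Finset.mem_range]
        exact hx.2
    _ ≤ f t := hfg t

/-! ### Partial sums of the Hilbert function of a cut -/

/-- **The exact one-cut inequality** `∑_{s ≤ t} H_{J'}(s) ≤ H_J(t)` for `J + (Q) ≤ J'` with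
`Q ∈ Box(1)` a non-zero-divisor modulo `J ≠ (1)`: the section inequality
`H_{J+(Q)}(s) + H_J(s-1) ≤ H_J(s)` (LNM 1752, Ch. 11, §2.2 (iii)) telescoped over `s ≤ t`. This is
the exact form of the step whose lossy form is `GaGm.succ_mul_hilbI_le`.
[cite: NesterenkoPhilippon2001, Ch. 11 §2.2 (iii)] -/
theorem sum_hilbI_le_of_nzd {J J' : Ideal (MvPolynomial (Fin (n + 1)) ℂ)} (hJ : J ≠ ⊤)
    {Q : MvPolynomial (Fin (n + 1)) ℂ} (hQB : Q ∈ Box (n := n) D₀ D₁ 1) (hQ : IsNZDMod J Q)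
    (hJ' : J ⊔ Ideal.span {Q} ≤ J') (t : ℕ) :
    ∑ s ∈ Finset.range (t + 1), hilbI (n := n) D₀ D₁ (J'.restrictScalars ℂ) s ≤
      hilbI D₀ D₁ (J.restrictScalars ℂ) t := by
  have hsum := sum_hilbI_le (n := n) (D₀ := D₀) (D₁ := D₁)
    (J := (J ⊔ Ideal.span {Q}).restrictScalars ℂ) (P := J.restrictScalars ℂ)
    (fun x hx => Ideal.mem_sup_left hx) (fun s hs => hilbI_sup_span_add_le_of_nzd hJ hQB hQ hs) t
  refine le_trans (Finset.sum_le_sum fun s _ => ?_) hsum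
  exact hilbI_antitone (n := n) (D₀ := D₀) (D₁ := D₁) (fun x hx => hJ' hx) s

/-! ### Transport down a chain of cuts -/

/-- **Transport of a binomial minorant down a chain of cuts.** Let `𝔍 : ℕ → Ideal` with
`𝔍 j + (Q (j+1)) ≤ 𝔍 (j+1)` and `Q (j+1) ∈ Box(1)` a non-zero-divisor modulo `𝔍 j ≠ (1)` for
`j < r`. If `∑ᵢ ρᵢ·binom(t - cᵢ + k, k) ≤ H_{𝔍 j}(t)` for `t ≥ t₀` (`j ≤ r`), then for suitable
`cᵢ', t₀'`: `∑ᵢ ρᵢ·binom(t - cᵢ' + k + j, k + j) ≤ H_{𝔍 0}(t)` for `t ≥ t₀'` — the same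
coefficients `ρᵢ`, dimension raised by `j` (iterated partial sums, `S^j H_{𝔍 j} ≤ H_{𝔍 0}`).
[cite: NesterenkoPhilippon2001, Ch. 11 Prop. 2.2 (proof, exact form)] -/
theorem chain_transport (𝔍 : ℕ → Ideal (MvPolynomial (Fin (n + 1)) ℂ))
    (Q : ℕ → MvPolynomial (Fin (n + 1)) ℂ) (r : ℕ)
    (hne : ∀ j < r, 𝔍 j ≠ ⊤) (hQB : ∀ j < r, Q (j + 1) ∈ Box (n := n) D₀ D₁ 1)
    (hQ : ∀ j < r, IsNZDMod (𝔍 j) (Q (j + 1)))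
    (hstep : ∀ j < r, 𝔍 j ⊔ Ideal.span {Q (j + 1)} ≤ 𝔍 (j + 1))
    {ι : Type*} (s : Finset ι) (ρ : ι → ℕ) :
    ∀ j, j ≤ r → ∀ (k : ℕ) (c : ι → ℕ) (t₀ : ℕ),
      (∀ t, t₀ ≤ t → ∑ i ∈ s, ρ i * (t - c i + k).choose k ≤
        hilbI (n := n) D₀ D₁ ((𝔍 j).restrictScalars ℂ) t) →
      ∃ (c' : ι → ℕ) (t₀' : ℕ), ∀ t, t₀' ≤ t →
        ∑ i ∈ s, ρ i * (t - c' i + (k + j)).choose (k + j) ≤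
          hilbI (n := n) D₀ D₁ ((𝔍 0).restrictScalars ℂ) t := by
  intro j
  induction j with
  | zero =>
    intro _ k c t₀ h
    exact ⟨c, t₀, fun t ht => by simpa only [Nat.add_zero] using h t ht⟩
  | succ j ih =>
    intro hjr k c t₀ h
    have hj : j < r := by omega
    -- one step: from `H_{𝔍 (j+1)}` in dimension `k` to `H_{𝔍 j}` in dimension `k + 1`
    have h1 : ∀ t, t₀ ≤ t → ∑ i ∈ s, ρ i * (t - (c i + t₀) + (k + 1)).choose (k + 1) ≤
        hilbI (n := n) D₀ D₁ ((𝔍 j).restrictScalars ℂ) t :=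
      sum_mul_choose_succ_le s ρ c k t₀
        (fun t => sum_hilbI_le_of_nzd (hne j hj) (hQB j hj) (hQ j hj) (hstep j hj) t) h
    obtain ⟨c', t₀', h2⟩ := ih (by omega) (k + 1) (fun i => c i + t₀) t₀ h1
    refine ⟨c', t₀', fun t ht => ?_⟩
    rw [show k + (j + 1) = k + 1 + j by omega]
    exact h2 t ht

/-- `H_{(0)}(t) = H_G(t)`: the Hilbert function of the zero ideal is that of the whole group.
[folklore] -/
private theorem hilbI_bot_eq_hilb_univ (t : ℕ) :
    hilbI (n := n) D₀ D₁ ((⊥ : Ideal (MvPolynomial (Fin (n + 1)) ℂ)).restrictScalars ℂ) t =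
      hilb D₀ D₁ (Set.univ : Set (GaGm n)) t := by
  rw [hilb, vanishing_univ]

/-- **The exact Bézout inequality along a chain of cuts** (Roy's Prop. 2.2 with the sharp constant
`𝓗(G; D₀, D₁) = (n+1)! D₀ D₁ⁿ`, in leading-coefficient form). Let `(0) = 𝔍 0`, and for `j < r` let
`𝔍 j + (Q (j+1)) ≤ 𝔍 (j+1)` with `Q (j+1) ∈ Box(1)` a non-zero-divisor modulo `𝔍 j ≠ (1)`. If
`k + r = n + 1` and `∑ᵢ ρᵢ·binom(t - cᵢ + k, k) ≤ H_{𝔍 r}(t)` for all `t ≥ t₀`, then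
`∑ᵢ ρᵢ ≤ (n+1)! · D₀ · D₁ⁿ` — no factor `2^{(n+1)r}` (compare `GaGm.hilbI_chain_le`).
[cite: NesterenkoPhilippon2001, Ch. 11 Prop. 2.2] -/
theorem sum_le_of_chain (hD₀ : 1 ≤ D₀) (hD₁ : 1 ≤ D₁)
    (𝔍 : ℕ → Ideal (MvPolynomial (Fin (n + 1)) ℂ)) (Q : ℕ → MvPolynomial (Fin (n + 1)) ℂ) (r k : ℕ)
    (h0 : 𝔍 0 = ⊥) (hne : ∀ j < r, 𝔍 j ≠ ⊤) (hQB : ∀ j < r, Q (j + 1) ∈ Box (n := n) D₀ D₁ 1)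
    (hQ : ∀ j < r, IsNZDMod (𝔍 j) (Q (j + 1)))
    (hstep : ∀ j < r, 𝔍 j ⊔ Ideal.span {Q (j + 1)} ≤ 𝔍 (j + 1)) (hk : k + r = n + 1)
    {ι : Type*} (s : Finset ι) (ρ c : ι → ℕ) (t₀ : ℕ)
    (hlow : ∀ t, t₀ ≤ t → ∑ i ∈ s, ρ i * (t - c i + k).choose k ≤
      hilbI (n := n) D₀ D₁ ((𝔍 r).restrictScalars ℂ) t) :
    ∑ i ∈ s, ρ i ≤ (n + 1).factorial * D₀ * D₁ ^ n := by
  obtain ⟨c', t₀', h'⟩ := chain_transport 𝔍 Q r hne hQB hQ hstep s ρ r le_rfl k c t₀ hlow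
  rw [hk, h0] at h'
  obtain ⟨a, γ, hsand⟩ := hasMult_univ (n := n) hD₀ hD₁
  refine Asymp.sum_le_of_choose_ineq s ((n + 1).factorial * D₀ * D₁ ^ n) ρ c' γ (n + 1) (t₀' + a)
    fun t ht => ?_
  have h1 := h' t (by omega)
  have h2 := (hsand t (by omega)).2
  rw [dimG_univ] at h2
  rw [hilbI_bot_eq_hilb_univ] at h1
  exact h1.trans h2

/-! ### The chain of generic cuts, exported as a chain -/

section Chain

variable {ι : Type*} [Fintype ι] (𝔭 : ι → Ideal (MvPolynomial (Fin (n + 1)) ℂ)) (h𝔭 : ∀ i, (𝔭 i).IsPrime)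
  (Fset : Finset (MvPolynomial (Fin (n + 1)) ℂ)) (r : ℕ)
  (hDH : ∀ 𝔭' : Ideal (MvPolynomial (Fin (n + 1)) ℂ), 𝔭'.IsPrime → (∃ i, 𝔭' ≤ 𝔭 i) →
    (↑Fset : Set (MvPolynomial (Fin (n + 1)) ℂ)) ⊆ 𝔭' → (r : ℕ∞) ≤ 𝔭'.height)

include hDH in
/-- **The chain of the generic complete intersection, localised at the `𝔭ᵢ`** (the construction of
`GaGm.exists_ideal_hilbI_le`, exported as a chain). For finitely many primes `𝔭ᵢ` (`ι` non-empty),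
a finite `F ⊆ Box(1) ∩ ⋂ᵢ 𝔭ᵢ` such that every prime `𝔭' ⊆ 𝔭ᵢ` containing `F` has height `≥ r`:
there are ideals `(0) = 𝔍 0, 𝔍 1, …, 𝔍 r` and `Q 1, …, Q r ∈ Box(1)` with
`𝔍 j + (Q (j+1)) ≤ 𝔍 (j+1)`, `Q (j+1)` a non-zero-divisor modulo `𝔍 j ≠ (1)` (`j < r`), and
`𝔍 r ≤ loc_{𝔭ᵢ}(F)` for all `i` (`𝔍 j = ⋂ᵢ loc_{𝔭ᵢ}(Q 1, …, Q j)` for the generic sequence of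
`GaGm.exists_list_avoids`; the non-zero-divisor property is `GaGm.isNZDMod_loc_ofList`, i.e. the
Cohen–Macaulay property of `B_{𝔭ᵢ}`). [cite: NesterenkoPhilippon2001, Ch. 11 Prop. 2.2 (proof)] -/
theorem exists_chain [Nonempty ι]
    (hFBox : (↑Fset : Set (MvPolynomial (Fin (n + 1)) ℂ)) ⊆ (Box (n := n) D₀ D₁ 1 : Set (MvPolynomial (Fin (n + 1)) ℂ)))
    (hF𝔭 : ∀ i, (↑Fset : Set (MvPolynomial (Fin (n + 1)) ℂ)) ⊆ (𝔭 i : Set (MvPolynomial (Fin (n + 1)) ℂ))) :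
    ∃ (𝔍 : ℕ → Ideal (MvPolynomial (Fin (n + 1)) ℂ)) (Q : ℕ → MvPolynomial (Fin (n + 1)) ℂ),
      𝔍 0 = ⊥ ∧ (∀ j < r, 𝔍 j ≠ ⊤) ∧ (∀ j < r, Q (j + 1) ∈ Box (n := n) D₀ D₁ 1) ∧
      (∀ j < r, IsNZDMod (𝔍 j) (Q (j + 1))) ∧
      (∀ j < r, 𝔍 j ⊔ Ideal.span {Q (j + 1)} ≤ 𝔍 (j + 1)) ∧
      ∀ i, 𝔍 r ≤ loc (𝔭 i) (h𝔭 i) (Ideal.span (↑Fset : Set (MvPolynomial (Fin (n + 1)) ℂ))) := by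
  -- adapted from the tree's `GaGm.exists_ideal_hilbI_le` (PhilipponZeroEstimateChain.lean)
  classical
  obtain ⟨Qs, hlen, hspan, hav⟩ := exists_list_avoids 𝔭 Fset r hDH r le_rfl
  -- basic inclusions
  have hspanBox : Submodule.span ℂ (↑Fset : Set (MvPolynomial (Fin (n + 1)) ℂ)) ≤ Box (n := n) D₀ D₁ 1 :=
    Submodule.span_le.mpr hFBox
  have hspan𝔭 : ∀ i, Submodule.span ℂ (↑Fset : Set (MvPolynomial (Fin (n + 1)) ℂ)) ≤ (𝔭 i).restrictScalars ℂ :=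
    fun i => Submodule.span_le.mpr (hF𝔭 i)
  have hspanI : Submodule.span ℂ (↑Fset : Set (MvPolynomial (Fin (n + 1)) ℂ)) ≤
      (Ideal.span (↑Fset : Set (MvPolynomial (Fin (n + 1)) ℂ))).restrictScalars ℂ :=
    Submodule.span_le.mpr fun x hx => Ideal.subset_span hx
  have hofList : ∀ L : List (MvPolynomial (Fin (n + 1)) ℂ), (∀ Q ∈ L, Q ∈ Qs) →
      ∀ i, Ideal.ofList L ≤ 𝔭 i := fun L hL i => by
    rw [Ideal.ofList, Ideal.span_le]
    intro Q hQ
    exact hspan𝔭 i (hspan Q (hL Q hQ))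
  -- the chain
  let 𝔍 : ℕ → Ideal (MvPolynomial (Fin (n + 1)) ℂ) := fun j =>
    Finset.univ.inf fun i => loc (𝔭 i) (h𝔭 i) (Ideal.ofList (Qs.take j))
  let Q : ℕ → MvPolynomial (Fin (n + 1)) ℂ := fun j => Qs.getD (j - 1) 0
  have hQmem : ∀ j < r, Q (j + 1) ∈ Qs := fun j hj => by
    simp only [Q, Nat.add_sub_cancel]
    rw [List.getD_eq_getElem _ _ (by omega)]
    exact List.getElem_mem _
  have hdec : ∀ j < r, Qs = Qs.take j ++ Q (j + 1) :: Qs.drop (j + 1) := fun j hj => by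
    simp only [Q, Nat.add_sub_cancel]
    rw [List.getD_eq_getElem _ _ (by omega), ← List.drop_eq_getElem_cons (by omega), List.take_append_drop]
  have h0 : 𝔍 0 = ⊥ := by
    show Finset.univ.inf (fun i => loc (𝔭 i) (h𝔭 i) (Ideal.ofList (Qs.take 0))) = ⊥
    simp only [List.take_zero, Ideal.ofList_nil, loc_bot 𝔭 h𝔭]
    exact Finset.inf_const Finset.univ_nonempty _
  have hne : ∀ j < r, 𝔍 j ≠ ⊤ := fun j hj htop => by
    obtain ⟨i⟩ := ‹Nonempty ι›
    have h1 : 𝔍 j ≤ 𝔭 i := (Finset.inf_le (Finset.mem_univ i)).trans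
      (loc_le (h𝔭 i) (hofList _ (fun Q hQ => List.mem_of_mem_take hQ) i))
    exact (h𝔭 i).ne_top (top_le_iff.mp (htop ▸ h1))
  have hQB : ∀ j < r, Q (j + 1) ∈ Box (n := n) D₀ D₁ 1 := fun j hj => hspanBox (hspan _ (hQmem j hj))
  have hQnzd : ∀ j < r, IsNZDMod (𝔍 j) (Q (j + 1)) := fun j hj =>
    isNZDMod_finsetInf _ _ fun i _ => by
      haveI := h𝔭 i
      exact isNZDMod_loc_ofList (𝔭 i) (fun q hq => hspan𝔭 i (hspan q hq)) (hav i) (hdec j hj)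
  have hstep : ∀ j < r, 𝔍 j ⊔ Ideal.span {Q (j + 1)} ≤ 𝔍 (j + 1) := fun j hj => by
    have htake : Qs.take (j + 1) = Qs.take j ++ [Q (j + 1)] := by
      simp only [Q, Nat.add_sub_cancel]
      rw [List.getD_eq_getElem _ _ (by omega), List.take_succ_eq_append_getElem (by omega)]
    refine Finset.le_inf fun i _ => sup_le ((Finset.inf_le (Finset.mem_univ i)).trans (loc_mono (h𝔭 i) ?_)) ?_
    · rw [htake, Ideal.ofList_append]; exact le_sup_left
    · rw [Ideal.span_singleton_le_iff_mem]
      refine le_loc (h𝔭 i) _ ?_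
      rw [htake, Ideal.ofList_append, Ideal.ofList_singleton]
      exact Ideal.mem_sup_right (Ideal.mem_span_singleton_self _)
  refine ⟨𝔍, Q, h0, hne, hQB, hQnzd, hstep, fun i => (Finset.inf_le (Finset.mem_univ i)).trans (loc_mono (h𝔭 i) ?_)⟩
  rw [List.take_of_length_le (by omega), Ideal.ofList, Ideal.span_le]
  intro q hq
  exact hspanI (hspan q hq)

include hDH in
/-- **The ideal of the generic complete intersection and its exact Bézout bound** (Roy's
Prop. 2.2 with the sharp constant, in leading-coefficient form): under the hypotheses of
`exists_chain` and `r ≤ n + 1`, `D₀, D₁ ≥ 1`, there is an ideal `𝔍` with `𝔍 ≤ loc_{𝔭ᵢ}(F)` for all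
`i` such that every binomial minorant `∑ᵢ ρᵢ·binom(t - cᵢ + (n+1-r), n+1-r) ≤ H_𝔍(t)` (`t ≥ t₀`)
has `∑ᵢ ρᵢ ≤ (n+1)! D₀ D₁ⁿ`. The exact replacement of `GaGm.exists_ideal_hilbI_le`.
[cite: NesterenkoPhilippon2001, Ch. 11 Prop. 2.2] -/
theorem exists_ideal_sum_le [Nonempty ι] (hD₀ : 1 ≤ D₀) (hD₁ : 1 ≤ D₁) (hr : r ≤ n + 1)
    (hFBox : (↑Fset : Set (MvPolynomial (Fin (n + 1)) ℂ)) ⊆ (Box (n := n) D₀ D₁ 1 : Set (MvPolynomial (Fin (n + 1)) ℂ)))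
    (hF𝔭 : ∀ i, (↑Fset : Set (MvPolynomial (Fin (n + 1)) ℂ)) ⊆ (𝔭 i : Set (MvPolynomial (Fin (n + 1)) ℂ)))
    {κ : Type*} (s : Finset κ) (ρ : κ → ℕ) :
    ∃ 𝔍 : Ideal (MvPolynomial (Fin (n + 1)) ℂ),
      (∀ i, 𝔍 ≤ loc (𝔭 i) (h𝔭 i) (Ideal.span (↑Fset : Set (MvPolynomial (Fin (n + 1)) ℂ)))) ∧
      ∀ (c : κ → ℕ) (t₀ : ℕ),
        (∀ t, t₀ ≤ t → ∑ i ∈ s, ρ i * (t - c i + (n + 1 - r)).choose (n + 1 - r) ≤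
          hilbI (n := n) D₀ D₁ (𝔍.restrictScalars ℂ) t) →
        ∑ i ∈ s, ρ i ≤ (n + 1).factorial * D₀ * D₁ ^ n := by
  obtain ⟨𝔍, Q, h0, hne, hQB, hQ, hstep, hle⟩ := exists_chain 𝔭 h𝔭 Fset r hDH (D₀ := D₀) (D₁ := D₁) hFBox hF𝔭
  exact ⟨𝔍 r, hle, fun c t₀ hlow =>
    sum_le_of_chain hD₀ hD₁ 𝔍 Q r (n + 1 - r) h0 hne hQB hQ hstep (by omega) s ρ c t₀ hlow⟩

end Chain

end GaGm

end Literature.NumberTheory.Transcendental
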